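import Mathlib.Tactic.Linarith
import Mathlib.Tactic.Ring
import Mathlib.Tactic.Positivity
import Mathlib.Tactic.Zify
import Mathlib.Tactic.LinearCombination
import Literature.Combinatorics.Additive.TripleProductProperty
import Literature.Combinatorics.Additive.TPPGroupAlgebra
import Summits.MatrixMultiplication.OmegaCensus.DihedralLikeTiling
import Summits.MatrixMultiplication.OmegaCensus.DihedralLikeLaw
import Summits.MatrixMultiplication.OmegaCensus.DicyclicLawModOne
import Summits.MatrixMultiplication.OmegaCensus.CyclicOfNearTiling
import Summits.MatrixMultiplication.OmegaCensus.DihedralLawShape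
import HarnessLib

/-!
# The generalized dihedral law `4⌊2|A|/3⌋` is attained only over cyclic `A` (`|A| ≡ 2 (mod 3)`)

ω-census, family (b3).  Framing: lottery ticket; floor = certified bounds/negative ranges.

**Theorem (`zmultiples_of_law_attained`).** Let `G` have a dihedral-like presentation `ρ, τ : A → G` over the
finite abelian group `A` (`ρaρb = ρ(a+b)`, `ρaτb = τ(b−a)`, `τaρb = τ(a+b)`, `τaτb = ρ(c₀+b−a)`; generalized dihedral
and dicyclic groups), `|A| ≡ 2 (mod 3)`, `|A|` even, `|A| ≥ 14`.  If some TPP triple attains the dihedral-like law,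
`3|S||T||U| + 4 = 8|A|` (i.e. `|S||T||U| = 4⌊2|A|/3⌋`, `DihedralLikeLaw.lean`), then `A` is cyclic.  Equivalently
(`tpp_volume_lt_law_of_not_cyclic`): over a non-cyclic `A` every TPP triple has `3|S||T||U| + 7 ≤ 8|A|`.
For cyclic `A = ZMod n` the law is attained (`dihedral_law`), so for `|A| ≡ 2 (mod 3)` the law characterizes
cyclicity; e.g. `β(ℤ₂ × D₈) < 20 = β(D₁₆)` (census: `16`), `β(ℤ₂ × D₂₀) < 52 = β(D₄₀)`.

**Proof.** (1) `parts_law_shape` (`DihedralLawShape.lean`): by the A-level classification (`parts_mod_two`) and Newton's inequalities a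
law-attaining size vector has both triangles tiling (excluded by `three_dvd_of_double_tiling'`) or triangle sums
`(|A|, |A|−1)` with `3A₀ = |A|+1`, `3A₃ = |A|−2` (or the mirror image); by Vieta the three parts of the tiling
triangle are then `{q+1, q+1, q}` (`|A| = 3q+2`), which forces two of the three sets to be `{ρs, τs'}`, `{ρt, τt'}`
and the third to have parts of sizes `q+1, q`.  (2) `cyclic_of_law_shape`: the two triangles are then
`(s'+t+U₀) ⊔ (s+t'+U₀) ⊔ (s+t+U₁) = A` with `(s+t'+U₁) ∩ (s'+t+U₁) = ∅`, a near-tiling by two `d`-translates,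
`d = (s'+t) − (s+t')`, so `⟨d⟩ = A` (`zmultiples_eq_top_of_near_tiling`, `CyclicOfNearTiling.lean`).
-/

namespace Summit.MatrixMultiplication.OmegaCensus

open Literature.Combinatorics.Additive Finset

/-! ## From the shape to a near-tiling of `A` -/

section DihedralLike

variable {A : Type*} [AddCommGroup A] [DecidableEq A] [Fintype A] {G : Type} [Group G] [DecidableEq G]
  {ρ τ : A → G} {c₀ : A} {S T U : Finset G}

omit [Fintype A] in
/-- Translating the sumset `{a} + {b} + W` by `(a'+b') − (a+b)` gives `{a'} + {b'} + W`. [folklore] -/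
theorem image_sumset_pair_shift (a b a' b' : A) (W : Finset A) :
    ((({a} : Finset A) ×ˢ ({b} : Finset A) ×ˢ W).image fun p : A × A × A => p.1 + p.2.1 + p.2.2).image
        (fun x => x + (a' + b' - (a + b))) =
      (({a'} : Finset A) ×ˢ ({b'} : Finset A) ×ˢ W).image fun p : A × A × A => p.1 + p.2.1 + p.2.2 := by
  ext x
  constructor
  · intro hx
    obtain ⟨y, hy, rfl⟩ := mem_image.1 hx
    obtain ⟨a₁, ha₁, b₁, hb₁, c, hc, rfl⟩ := mem_sumset₃.1 hy
    rw [mem_singleton] at ha₁ hb₁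
    subst a₁
    subst b₁
    exact mem_sumset₃.2 ⟨a', mem_singleton_self _, b', mem_singleton_self _, c, hc, by abel⟩
  · intro hx
    obtain ⟨a₁, ha₁, b₁, hb₁, c, hc, rfl⟩ := mem_sumset₃.1 hx
    rw [mem_singleton] at ha₁ hb₁
    subst a₁
    subst b₁
    exact mem_image.2 ⟨a + b + c, mem_sumset₃.2 ⟨a, mem_singleton_self _, b, mem_singleton_self _, c, hc, rfl⟩,
      by abel⟩

/-- **From the extremal shape to cyclicity.** A TPP triple with `S = {ρs, τs'}`, `T = {ρt, τt'}` (one element in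
each coset) and `U`-parts of sizes `(q+1, q)` with `2(q+1) + q = |A|` (or `(q, q+1)` with `2(q+1) + q = |A|`)
forces `A = ⟨(s'+t) − (s+t')⟩`. [folklore] -/
theorem cyclic_of_law_shape (hρρ : ∀ a b, ρ a * ρ b = ρ (a + b)) (hρτ : ∀ a b, ρ a * τ b = τ (b - a))
    (hτρ : ∀ a b, τ a * ρ b = τ (a + b)) (hττ : ∀ a b, τ a * τ b = ρ (c₀ + b - a))
    (hρ : Function.Injective ρ) (hτ : Function.Injective τ) (hne : ∀ a b, ρ a ≠ τ b)
    (h : TripleProductProperty S T U)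
    (hs₀ : (univ.filter fun a : A => ρ a ∈ S).card = 1) (hs₁ : (univ.filter fun a : A => τ a ∈ S).card = 1)
    (ht₀ : (univ.filter fun a : A => ρ a ∈ T).card = 1) (ht₁ : (univ.filter fun a : A => τ a ∈ T).card = 1)
    (hu : ((univ.filter fun a : A => ρ a ∈ U).card = (univ.filter fun a : A => τ a ∈ U).card + 1 ∧
        2 * (univ.filter fun a : A => ρ a ∈ U).card + (univ.filter fun a : A => τ a ∈ U).card = Fintype.card A) ∨
      ((univ.filter fun a : A => τ a ∈ U).card = (univ.filter fun a : A => ρ a ∈ U).card + 1 ∧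
        2 * (univ.filter fun a : A => τ a ∈ U).card + (univ.filter fun a : A => ρ a ∈ U).card = Fintype.card A)) :
    ∃ g : A, ∀ x : A, x ∈ AddSubgroup.zmultiples g := by
  set U₀ : Finset A := univ.filter fun a => ρ a ∈ U with hU₀
  set U₁ : Finset A := univ.filter fun a => τ a ∈ U with hU₁
  obtain ⟨s, hsS⟩ := card_eq_one.1 hs₀
  obtain ⟨s', hsS'⟩ := card_eq_one.1 hs₁
  obtain ⟨t, htT⟩ := card_eq_one.1 ht₀
  obtain ⟨t', htT'⟩ := card_eq_one.1 ht₁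
  have ms : ρ s ∈ S := by
    have hm := mem_singleton_self s; rw [← hsS] at hm; exact (mem_filter.1 hm).2
  have ms' : τ s' ∈ S := by
    have hm := mem_singleton_self s'; rw [← hsS'] at hm; exact (mem_filter.1 hm).2
  have mt : ρ t ∈ T := by
    have hm := mem_singleton_self t; rw [← htT] at hm; exact (mem_filter.1 hm).2
  have mt' : τ t' ∈ T := by
    have hm := mem_singleton_self t'; rw [← htT'] at hm; exact (mem_filter.1 hm).2
  have mρs : ∀ a ∈ ({s} : Finset A), ρ a ∈ S := fun a ha => by rw [mem_singleton.1 ha]; exact ms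
  have mτs' : ∀ a ∈ ({s'} : Finset A), τ a ∈ S := fun a ha => by rw [mem_singleton.1 ha]; exact ms'
  have mρt : ∀ a ∈ ({t} : Finset A), ρ a ∈ T := fun a ha => by rw [mem_singleton.1 ha]; exact mt
  have mτt' : ∀ a ∈ ({t'} : Finset A), τ a ∈ T := fun a ha => by rw [mem_singleton.1 ha]; exact mt'
  have mρs_c : ∀ a ∈ ({s} : Finset A), cond false (τ a) (ρ a) ∈ S := mρs
  have mτs'_c : ∀ a ∈ ({s'} : Finset A), cond true (τ a) (ρ a) ∈ S := mτs'
  have mρt_c : ∀ a ∈ ({t} : Finset A), cond false (τ a) (ρ a) ∈ T := mρt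
  have mτt'_c : ∀ a ∈ ({t'} : Finset A), cond true (τ a) (ρ a) ∈ T := mτt'
  have mU₀ : ∀ a ∈ U₀, ρ a ∈ U := fun a ha => (mem_filter.1 ha).2
  have mU₁ : ∀ a ∈ U₁, τ a ∈ U := fun a ha => (mem_filter.1 ha).2
  have mU₀_c : ∀ a ∈ U₀, cond false (τ a) (ρ a) ∈ U := mU₀
  have mU₁_c : ∀ a ∈ U₁, cond true (τ a) (ρ a) ∈ U := mU₁
  have cs := card_sumset' hρρ hττ hρ hτ h
  have d₁ := disjoint_sumset₁' hρρ hρτ hτρ hττ hne h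
  have d₂ := disjoint_sumset₂' hρρ hρτ hτρ hττ hne h
  have d₃ := disjoint_sumset₃' hρρ hρτ hτρ hττ hne h
  refine ⟨s' + t - (s + t'), ?_⟩
  -- the four relevant sumsets
  have cY := cs false true false mρs_c mτt'_c mU₀_c   -- |s + t' + U₀| = |U₀|
  have cZ := cs false false true mρs_c mρt_c mU₁_c   -- |s + t + U₁| = |U₁|
  have cX' := cs false true true mρs_c mτt'_c mU₁_c   -- |s + t' + U₁| = |U₁|
  have cZ' := cs true true false mτs'_c mτt'_c mU₀_c  -- |s' + t' + U₀| = |U₀|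
  simp only [card_singleton, one_mul] at cY cZ cX' cZ'
  have hXY := d₁ false mτs' mρt mU₀_c mρs mτt'    -- `X ∩ Y = ∅`
  have hX'Y' := d₁ true mτs' mρt mU₁_c mρs mτt'   -- `Y' ∩ X' = ∅`
  rcases hu with ⟨hcard, hsum⟩ | ⟨hcard, hsum⟩
  · -- triangle 1 tiles: `P = s + t' + U₀`, `P + d = s' + t + U₀`, `C = s + t + U₁`
    have hPimg := image_sumset_pair_shift s t' s' t U₀
    refine zmultiples_eq_top_of_near_tiling
      (P := (({s} : Finset A) ×ˢ ({t'} : Finset A) ×ˢ U₀).image fun p : A × A × A => p.1 + p.2.1 + p.2.2)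
      (C := (({s} : Finset A) ×ˢ ({t} : Finset A) ×ˢ U₁).image fun p : A × A × A => p.1 + p.2.1 + p.2.2)
      (d₂ false mρs_c mτt' mU₀ mρs_c mρt mU₁) ?_ ?_ ?_ ?_ ?_
    · rw [hPimg]; exact (d₃ false mρs mρt_c mU₁ mτs' mU₀).symm
    · apply eq_univ_of_card
      rw [card_union_of_disjoint (disjoint_union_left.2 ⟨d₂ false mρs_c mτt' mU₀ mρs_c mρt mU₁,
        by rw [hPimg]; exact (d₃ false mρs mρt_c mU₁ mτs' mU₀).symm⟩),
        card_union_of_disjoint (by rw [hPimg]; exact (hXY).symm), card_image_of_injective _ (add_left_injective _),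
        cY, cZ]
      omega
    · rw [disjoint_left]
      intro x hx hx'
      rw [mem_sumset₃] at hx
      obtain ⟨a, ha, b, hb, c₁, hc₁, rfl⟩ := hx
      rw [mem_singleton] at ha hb
      subst a
      subst b
      obtain ⟨y, hy, hyx⟩ := mem_image.1 hx'
      rw [mem_sumset₃] at hy
      obtain ⟨a, ha, b, hb, c₂, hc₂, rfl⟩ := hy
      rw [mem_singleton] at ha hb
      subst a
      subst b
      -- `z = s + t' + c₁ = s' + t + c₂` lies in `X' ∩ Y'`
      have hz1 : s' + t + c₂ ∈ ((({s'} : Finset A) ×ˢ ({t} : Finset A) ×ˢ U₁).image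
          fun p : A × A × A => p.1 + p.2.1 + p.2.2) :=
        mem_sumset₃.2 ⟨s', mem_singleton_self _, t, mem_singleton_self _, c₂, hc₂, rfl⟩
      have hz2 : s' + t + c₂ ∈ ((({s} : Finset A) ×ˢ ({t'} : Finset A) ×ˢ U₁).image
          fun p : A × A × A => p.1 + p.2.1 + p.2.2) :=
        mem_sumset₃.2 ⟨s, mem_singleton_self _, t', mem_singleton_self _, c₁, hc₁, by
          rw [← sub_eq_zero]; rw [← sub_eq_zero] at hyx
          have e : s + t' + c₁ - (s' + t + c₂) = -(s + t + c₂ + (s' + t - (s + t')) - (s + t + c₁)) := by abel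
          rw [e, hyx, neg_zero]⟩
      exact disjoint_left.1 hX'Y' hz1 hz2
    · rw [cY, cZ, hcard]
    · rw [hPimg]; exact hXY.symm
  · -- triangle 2 tiles: `P = s + t' + U₁`, `P + d = s' + t + U₁`, `C = s' + t' + U₀`
    have hPimg := image_sumset_pair_shift s t' s' t U₁
    refine zmultiples_eq_top_of_near_tiling
      (P := (({s} : Finset A) ×ˢ ({t'} : Finset A) ×ˢ U₁).image fun p : A × A × A => p.1 + p.2.1 + p.2.2)
      (C := (({s'} : Finset A) ×ˢ ({t'} : Finset A) ×ˢ U₀).image fun p : A × A × A => p.1 + p.2.1 + p.2.2)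
      (d₃ true mρs mτt'_c mU₁ mτs' mU₀) ?_ ?_ ?_ ?_ ?_
    · rw [hPimg]; exact (d₂ true mτs'_c mτt' mU₀ mτs'_c mρt mU₁).symm
    · apply eq_univ_of_card
      rw [card_union_of_disjoint (disjoint_union_left.2 ⟨d₃ true mρs mτt'_c mU₁ mτs' mU₀,
        by rw [hPimg]; exact (d₂ true mτs'_c mτt' mU₀ mτs'_c mρt mU₁).symm⟩),
        card_union_of_disjoint (by rw [hPimg]; exact hX'Y'.symm), card_image_of_injective _ (add_left_injective _),
        cX', cZ']
      omega
    · rw [disjoint_left]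
      intro x hx hx'
      rw [mem_sumset₃] at hx
      obtain ⟨a, ha, b, hb, c₁, hc₁, rfl⟩ := hx
      rw [mem_singleton] at ha hb
      subst a
      subst b
      obtain ⟨y, hy, hyx⟩ := mem_image.1 hx'
      rw [mem_sumset₃] at hy
      obtain ⟨a, ha, b, hb, c₂, hc₂, rfl⟩ := hy
      rw [mem_singleton] at ha hb
      subst a
      subst b
      -- `z = s + t' + c₁ = s' + t + c₂` lies in `X ∩ Y`
      have hz1 : s' + t + c₂ ∈ ((({s'} : Finset A) ×ˢ ({t} : Finset A) ×ˢ U₀).image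
          fun p : A × A × A => p.1 + p.2.1 + p.2.2) :=
        mem_sumset₃.2 ⟨s', mem_singleton_self _, t, mem_singleton_self _, c₂, hc₂, rfl⟩
      have hz2 : s' + t + c₂ ∈ ((({s} : Finset A) ×ˢ ({t'} : Finset A) ×ˢ U₀).image
          fun p : A × A × A => p.1 + p.2.1 + p.2.2) :=
        mem_sumset₃.2 ⟨s, mem_singleton_self _, t', mem_singleton_self _, c₁, hc₁, by
          rw [← sub_eq_zero]; rw [← sub_eq_zero] at hyx
          have e : s + t' + c₁ - (s' + t + c₂) = -(s' + t' + c₂ + (s' + t - (s + t')) - (s' + t' + c₁)) := by abel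
          rw [e, hyx, neg_zero]⟩
      exact disjoint_left.1 hXY hz1 hz2
    · rw [cX', cZ', hcard]
    · rw [hPimg]; exact hX'Y'.symm

/-- **The law `3|S||T||U| + 4 = 8|A|` is attained only over cyclic `A`** (`|A| ≡ 2 (mod 3)`, `|A|` even,
`|A| ≥ 14`; any `c₀`). [folklore] -/
theorem zmultiples_of_law_attained
    (hρρ : ∀ a b, ρ a * ρ b = ρ (a + b)) (hρτ : ∀ a b, ρ a * τ b = τ (b - a))
    (hτρ : ∀ a b, τ a * ρ b = τ (a + b)) (hττ : ∀ a b, τ a * τ b = ρ (c₀ + b - a))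
    (hρ : Function.Injective ρ) (hτ : Function.Injective τ) (hne : ∀ a b, ρ a ≠ τ b)
    (hsurj : ∀ g, (∃ a, ρ a = g) ∨ (∃ a, τ a = g)) (hmod : Fintype.card A % 3 = 2)
    (heven : Fintype.card A % 2 = 0) (hA : 14 ≤ Fintype.card A) (h : TripleProductProperty S T U)
    (hV : 3 * (S.card * T.card * U.card) + 4 = 8 * Fintype.card A) :
    ∃ g : A, ∀ x : A, x ∈ AddSubgroup.zmultiples g := by
  obtain ⟨h₀, h₃, h₁, h₂⟩ := parts_counting' hρρ hρτ hτρ hττ hρ hτ hne h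
  rw [card_eq_parts' hρ hτ hne hsurj S, card_eq_parts' hρ hτ hne hsurj T, card_eq_parts' hρ hτ hne hsurj U] at hV
  rcases parts_law_shape (Fintype.card A) _ _ _ _ _ _ hmod heven hA h₀ h₃ h₁ h₂ hV with
    ⟨hA0, hA3, hB1, hB2⟩ | ⟨hs₀, hs₁, ht₀, ht₁, hu⟩ | ⟨hs₀, hs₁, hu₀, hu₁, ht⟩ | ⟨ht₀, ht₁, hu₀, hu₁, hs⟩
  · -- both triangles tile: impossible, `3 ∤ |A|`
    exfalso
    have pos : ∀ {a b c : Finset A}, 1 ≤ a.card * b.card * c.card → a.Nonempty ∧ b.Nonempty ∧ c.Nonempty := by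
      intro a b c habc
      refine ⟨card_pos.1 (Nat.pos_of_ne_zero fun h0 => ?_), card_pos.1 (Nat.pos_of_ne_zero fun h0 => ?_),
        card_pos.1 (Nat.pos_of_ne_zero fun h0 => ?_)⟩ <;> simp [h0] at habc
    obtain ⟨neS₀, neT₀, neU₀⟩ := pos hA0
    obtain ⟨neS₁, neT₁, neU₁⟩ := pos hA3
    have h3 := three_dvd_of_double_tiling' hρρ hρτ hτρ hττ hρ hτ hne h neS₀ neS₁ neT₀ neT₁ neU₀ neU₁ hB1 hB2
    omega
  · exact cyclic_of_law_shape hρρ hρτ hτρ hττ hρ hτ hne h hs₀ hs₁ ht₀ ht₁ (by omega)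
  · -- `T` is the big set: rotate to `(U, S, T)`
    exact cyclic_of_law_shape hρρ hρτ hτρ hττ hρ hτ hne h.rotate.rotate hu₀ hu₁ hs₀ hs₁ (by omega)
  · -- `S` is the big set: rotate to `(T, U, S)`
    exact cyclic_of_law_shape hρρ hρτ hτρ hττ hρ hτ hne h.rotate ht₀ ht₁ hu₀ hu₁ (by omega)

/-- **Over a non-cyclic `A` the law is missed**: `3|S||T||U| + 7 ≤ 8|A|` for every TPP triple (`|A| ≡ 2 (mod 3)`,
even, `≥ 14`).  For cyclic `A` the law is attained (`dihedral_law`). [folklore] -/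
theorem tpp_volume_lt_law_of_not_cyclic [Fintype G]
    (hρρ : ∀ a b, ρ a * ρ b = ρ (a + b)) (hρτ : ∀ a b, ρ a * τ b = τ (b - a))
    (hτρ : ∀ a b, τ a * ρ b = τ (a + b)) (hττ : ∀ a b, τ a * τ b = ρ (c₀ + b - a))
    (hρ : Function.Injective ρ) (hτ : Function.Injective τ) (hne : ∀ a b, ρ a ≠ τ b)
    (hsurj : ∀ g, (∃ a, ρ a = g) ∨ (∃ a, τ a = g)) (hmod : Fintype.card A % 3 = 2)
    (heven : Fintype.card A % 2 = 0) (hA : 14 ≤ Fintype.card A)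
    (hnc : ¬ ∃ g : A, ∀ x : A, x ∈ AddSubgroup.zmultiples g) (h : TripleProductProperty S T U) :
    3 * (S.card * T.card * U.card) + 7 ≤ 8 * Fintype.card A := by
  have hle := tpp_volume_le_law_dihedralLike hρρ hρτ hτρ hττ hρ hτ hne hsurj (by omega) h
  by_contra hlt
  exact hnc (zmultiples_of_law_attained hρρ hρτ hτρ hττ hρ hτ hne hsurj hmod heven hA h (by omega))

end DihedralLike

end Summit.MatrixMultiplication.OmegaCensus
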